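import Mathlib.RingTheory.Smooth.IntegralClosure
import Mathlib.RingTheory.Etale.Field
import Mathlib.RingTheory.Smooth.Flat
import Mathlib.RingTheory.TensorProduct.Maps
import HarnessLib

/-!
# The ambient product of fields of an étale base change of a normal ring (Stacks 03GE)

Topic: `Literature/AlgebraicGeometry/Resolution`. Pure algebra for de Jong 1996, 4.12 ("Note that
`X'` is normal also. […] `Y' → ℙ^{d-1}` is (finite) étale"): let `P → B_V ⊆ K` with `K` a field
and `B_V` integrally closed in `K` (the sections of the normal `X'` over `f⁻¹V` inside `K(X')`),
and let `P → R` be étale (an étale neighbourhood `Spec R → V ⊆ ℙ^{d-1}`). Then the base change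
`S = B_V ⊗_P R` (the ring of `X' ×_V Spec R`) embeds into `E = S ⊗_{B_V} K ≅ K ⊗_P R`, a finite
product of fields (étale over the field `K`, Mathlib `Algebra.Etale.iff_exists_algEquiv_prod`),
and is integrally closed in it — integral closure commutes with smooth base change, Stacks 03GE
(Mathlib `TensorProduct.toIntegralClosure_bijective_of_smooth`). This is exactly the input of
`etale_of_idempotents_met_by_sections` (`SteinFinitePartEtaleCriterion.lean`).

* `exists_ambient_prod_fields_of_etale` — the statement, with `E`, the fields and the ring
  isomorphism existentially packaged.

[folklore]; no definitions, no named facts.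

## Sources

* The Stacks Project, Tag 03GE (integral closure and smooth base change), Tag 00U3.
  [StacksProject]
* A. J. de Jong, *Smoothness, semi-stability and alterations*, Publ. Math. IHÉS 83 (1996), 4.12,
  p. 68. [DeJong1996]
-/

noncomputable section

open TensorProduct

namespace Literature.AlgebraicGeometry.Resolution

universe u

/-- **Étale base change of a ring integrally closed in a field sits, integrally closed, in a
finite product of fields** (Stacks 03GE + 00U3): for `P → B_V ↪ K` (`K` a field, `B_V`
integrally closed in `K`) and `P → R` étale, `S = B_V ⊗_P R` injects into some `E ≃ ∏ᵢ Fᵢ`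
(fields; `E = S ⊗_{B_V} K ≅ K ⊗_P R`) and every element of `E` integral over `S` lies in `S`.
[cite: StacksProject, Tag 03GE] -/
theorem exists_ambient_prod_fields_of_etale
    {P BV K R : Type u} [CommRing P] [CommRing BV] [Field K] [CommRing R]
    [Algebra P BV] [Algebra BV K] [Algebra P K] [IsScalarTower P BV K] [Algebra P R]
    [Algebra.Etale P R]
    (hinjK : Function.Injective (algebraMap BV K))
    (hicK : ∀ z : K, IsIntegral BV z → z ∈ (algebraMap BV K).range) :
    ∃ (E : Type u) (_ : CommRing E) (_ : Algebra (BV ⊗[P] R) E) (ι : Type u) (_ : Fintype ι)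
      (_ : DecidableEq ι) (F : ι → Type u) (_ : ∀ i, Field (F i)) (_ : E ≃+* Π i, F i),
      Function.Injective (algebraMap (BV ⊗[P] R) E) ∧
      ∀ z : E, IsIntegral (BV ⊗[P] R) z → z ∈ (algebraMap (BV ⊗[P] R) E).range := by
  classical
  -- `E = S ⊗_{B_V} K ≅ K ⊗_P R` is a finite product of fields (`S = B_V ⊗_P R`)
  let ψ₁ : (BV ⊗[P] R) ⊗[BV] K ≃ₐ[BV] K ⊗[BV] (BV ⊗[P] R) :=
    Algebra.TensorProduct.comm BV (BV ⊗[P] R) K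
  let ψ₂ : K ⊗[BV] (BV ⊗[P] R) ≃ₐ[BV] K ⊗[P] R :=
    Algebra.TensorProduct.cancelBaseChange P BV BV K R
  obtain ⟨I, hI, Ai, _, _, eK, -⟩ :=
    (Algebra.Etale.iff_exists_algEquiv_prod K (K ⊗[P] R)).mp inferInstance
  letI : Fintype I := Fintype.ofFinite I
  let eE : (BV ⊗[P] R) ⊗[BV] K ≃+* Π i, Ai i :=
    (ψ₁.toRingEquiv.trans ψ₂.toRingEquiv).trans eK.toRingEquiv
  refine ⟨(BV ⊗[P] R) ⊗[BV] K, inferInstance, inferInstance, I, inferInstance, inferInstance, Ai,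
    inferInstance, eE, ?_, ?_⟩
  · -- injectivity: `S → E ≅ K ⊗_P R` is `B_V ⊗ R → K ⊗ R`, injective as `R` is `P`-flat
    let φ : BV ⊗[P] R →ₐ[P] K ⊗[P] R :=
      Algebra.TensorProduct.map (IsScalarTower.toAlgHom P BV K) (AlgHom.id P R)
    have hφ : Function.Injective φ := by
      have : Function.Injective ((IsScalarTower.toAlgHom P BV K).toLinearMap.rTensor R) :=
        Module.Flat.rTensor_preserves_injective_linearMap _ hinjK
      exact this
    have hcomp : ∀ x : BV ⊗[P] R,
        ψ₂ (ψ₁ (algebraMap (BV ⊗[P] R) ((BV ⊗[P] R) ⊗[BV] K) x)) = φ x := by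
      intro x
      induction x using TensorProduct.induction_on with
      | zero => simp
      | tmul b r =>
        change ψ₂ (ψ₁ ((b ⊗ₜ[P] r) ⊗ₜ[BV] (1 : K))) = φ (b ⊗ₜ r)
        simp only [ψ₁, ψ₂, φ]
        rw [Algebra.TensorProduct.comm_tmul, Algebra.TensorProduct.cancelBaseChange_tmul,
          Algebra.TensorProduct.map_tmul, AlgHom.id_apply, IsScalarTower.toAlgHom_apply,
          Algebra.algebraMap_eq_smul_one]
      | add x y hx hy => rw [map_add, map_add, map_add, hx, hy, map_add]
    intro x y hxy
    apply hφ
    rw [← hcomp, ← hcomp, hxy]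
  · -- integrally closed: Stacks 03GE for the smooth `B_V → S`, and `B_V` integrally closed in `K`
    intro z hz
    have hsurj := (TensorProduct.toIntegralClosure_bijective_of_smooth (R := BV) (S := BV ⊗[P] R)
      (B := K)).2
    obtain ⟨w, hw⟩ := hsurj ⟨z, hz⟩
    have hval : ∀ w : (BV ⊗[P] R) ⊗[BV] ↥(integralClosure BV K),
        ((TensorProduct.toIntegralClosure BV (BV ⊗[P] R) K) w).1 ∈
          (algebraMap (BV ⊗[P] R) ((BV ⊗[P] R) ⊗[BV] K)).range := by
      intro w
      induction w using TensorProduct.induction_on with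
      | zero => exact ⟨0, by simp⟩
      | tmul s c =>
        obtain ⟨b, hb⟩ := hicK c.1 c.2
        refine ⟨b • s, ?_⟩
        change (b • s) ⊗ₜ[BV] (1 : K) = (Algebra.TensorProduct.map (AlgHom.id (BV ⊗[P] R)
          (BV ⊗[P] R)) (integralClosure BV K).val) (s ⊗ₜ c)
        rw [Algebra.TensorProduct.map_tmul, AlgHom.id_apply, Subalgebra.coe_val, ← hb,
          Algebra.algebraMap_eq_smul_one, TensorProduct.smul_tmul]
      | add x y hx hy =>
        obtain ⟨a, ha⟩ := hx
        obtain ⟨b, hb⟩ := hy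
        exact ⟨a + b, by rw [map_add, ha, hb, map_add]; rfl⟩
    obtain ⟨s, hs⟩ := hval w
    exact ⟨s, by rw [hs, hw]⟩

end Literature.AlgebraicGeometry.Resolution

end
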